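import Summits.QuantumFields.YangMills.Theses.SqueezedSkewness

/-!
# Birth skeleton (BC3) for crux `SqueezedSkewness.VacuumDomination` (item stmt-QuantumFields-28192)

Planner ym-idea-6 g7, LINE A «vacuum domination» of route `SqueezedSkewness` (rev 7), bears_on rung R2a =
`BalabanLadder.NT` (stmt-QuantumFields-19353).  Two registered stubs and the kernel-checked composition
`VacuumDomination_of : ThermalLimit → LimitDomination → SqueezedSkewness.VacuumDomination`.

* `stub_thermalLimit` (M–L, engine): along the period-doubling chain `T_k = 2^k (2L+1)` over the spatial torus
  `(2L+1)^3`, the reflection form `Qrp β (2L+1) T_k s f` converges for every admissible `f` (finite-dimensional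
  transfer-matrix spectral calculus; cf. the PROVED `stub_chainSpectral` of `Cruxes/NT/Lines/thermal_descent_hs_birth.lean`
  and `Statement.stub_thermalLimit` of `Cruxes/ZeroTemperatureFloors/Lines/rung.lean`).
* `stub_limitDomination` (L, the Källén–Lehmann content): the limits satisfy `c² · Q∞(g) ≤ Q∞(f)` whenever
  `c · |LF_s g(E, p)| ≤ |LF_s f(E, p)|` for all `E ≥ 0`, `p ∈ ℝ³`.  Intended proof: OS reconstruction on the cylinder —
  `[B_f] = Σ_{t ≥ 1, x⃗} f(s(t, x⃗)) 𝒯^{t-1} U(x⃗) ψ` with ONE fixed vector `ψ = [A_(1,0⃗)]` (all six plaquettes based at the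
  site; time translations act by the positive contraction `𝒯 = 𝕋̂/λ₀`, spatial ones unitarily), the vacuum is unique
  (Jentzsch: the Wilson kernel is strictly positive), so `Q∞(f) = ‖P_Ω^⊥ [B_f]‖² = ∫ |Σ f μ^{t-1} e^{i s p·x⃗}|² dν_ψ(μ, p)`
  with a NON-NEGATIVE `f`-independent spectral measure; on `{μ > 0}` the amplitude is `μ^{-1} · LF_s f(E, p)`,
  `μ = e^{-E s}`; on `{μ = 0}` it is the slice-1 sum `lim_{E→∞} e^{E s} LF_s f(E, p)` — domination at all finite `E`
  passes to that limit, so zero modes of `𝕋` (e.g. `β = 0`) are covered.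
Nothing here proves `VacuumDomination`, NT or the mass gap; `sorry` occurs exactly in the two stubs.
-/

set_option autoImplicit false

namespace Summit.QuantumFields.YangMills.Cruxes.NT.VacuumDominationBirth

/-- Stub statement S1 (engine): the thermal limit of the reflection form exists along the doubling chain. -/
def ThermalLimit : Prop :=
  ∀ (G : Type) [Group G] [TopologicalSpace G] [IsTopologicalGroup G] [CompactSpace G], letI : MeasurableSpace G := borel G; haveI : BorelSpace G := ⟨rfl⟩; ∀ (r : Literature.MathematicalPhysics.QuantumFieldTheory.LatticeRep G), let St : ℕ → ℕ → Type := fun S T => Literature.MathematicalPhysics.QuantumFieldTheory.FinTorusSite S S S T; let Cfg : ℕ → ℕ → Type := fun S T => Literature.MathematicalPhysics.QuantumFieldTheory.FinTorusSite S S S T × Fin 4 → G; let cc : (n : ℕ) → Fin n → ℤ := fun n i => if 2 * i.val < n then (i.val : ℤ) else (i.val : ℤ) - n; let posE : (S T : ℕ) → St S T → EuclideanSpace ℝ (Fin 4) := fun S T x => Literature.MathematicalPhysics.QuantumLattice.siteToE (d := 4) ![cc T x.2.2.2, cc S x.1, cc S x.2.1, cc S x.2.2.1]; let P : (S T : ℕ)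 → St S T → Fin 4 → Fin 4 → Cfg S T → ℝ := fun _ _ x i j U => (r.ρ (Literature.MathematicalPhysics.QuantumFieldTheory.finTorusPlaquette U x i j)).trace.re; let A : (S T : ℕ) → St S T → Cfg S T → ℝ := fun S T x U => ∑ q : {q : Fin 4 × Fin 4 // q.1 < q.2}, P S T x q.1.1 q.1.2 U; let w : ℝ → (S T : ℕ) → Cfg S T → ℝ := fun β S T U => Real.exp (-β * ∑ x : St S T, ∑ q : {q : Fin 4 × Fin 4 // q.1 < q.2}, ((r.N : ℝ) - P S T x q.1.1 q.1.2 U)); let E : ℝ → (S T : ℕ) → (Cfg S T → ℝ) → ℝ := fun β S T F => (∫ U : Literature.MathematicalPhysics.QuantumFieldTheory.FinTorusSite S S S T × Fin 4 → G, F U * w β S T U ∂MeasureTheory.Measure.pi (fun _ => Literature.MathematicalPhysics.QuantumFieldTheory.haarProbability G)) / Literature.MathematicalPhysics.QuantumFieldTheory.wilsonFinTorusPartition r.ρ β S S S T; let Cov : ℝ → (S T : ℕ) → (Cfg S T → ℝ) → (Cfg S T → ℝ) → ℝ := fun β S T F F' => E β S T (fun U => F U * F' U) - E β S T F * E β S T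 F'; let refl : (S T : ℕ) → Cfg S T → Cfg S T := fun _ T U e => if e.2 = Fin.last 3 then (U ((e.1.1, e.1.2.1, e.1.2.2.1, Fin.rev e.1.2.2.2), Fin.last 3))⁻¹ else U ((e.1.1, e.1.2.1, e.1.2.2.1, ⟨(T - e.1.2.2.2.val) % T, Nat.mod_lt _ e.1.2.2.2.pos⟩), e.2); let B : (S T : ℕ) → ℝ → SchwartzMap (EuclideanSpace ℝ (Fin 4)) ℝ → Cfg S T → ℝ := fun S T s f U => ∑ x : St S T, f (s • posE S T x) * A S T x U; let Qrp : ℝ → (S T : ℕ) → ℝ → SchwartzMap (EuclideanSpace ℝ (Fin 4)) ℝ → ℝ := fun β S T s f => Cov β S T (fun U => B S T s f (refl S T U)) (B S T s f); ∀ (β : ℝ) (L : ℕ) (s R : ℝ) (f : SchwartzMap (EuclideanSpace ℝ (Fin 4)) ℝ), 0 ≤ β → 1 ≤ L → 0 < s → tsupport (f : EuclideanSpace ℝ (Fin 4) → ℝ) ⊆ {y : EuclideanSpace ℝ (Fin 4) | 0 < y 0} → tsupport (f : EuclideanSpace ℝ (Fin 4) → ℝ) ⊆ Metric.closedBall (0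 : EuclideanSpace ℝ (Fin 4)) R → R ≤ s * L → ∃ Q : ℝ, Filter.Tendsto (fun k : ℕ => Qrp β (2 * L + 1) (2 ^ k * (2 * L + 1)) s f) Filter.atTop (nhds Q)

/-- Stub statement S2 (Källén–Lehmann content): pointwise Laplace–Fourier domination ⇒ domination of the thermal limits. -/
def LimitDomination : Prop :=
  ∀ (G : Type) [Group G] [TopologicalSpace G] [IsTopologicalGroup G] [CompactSpace G], letI : MeasurableSpace G := borel G; haveI : BorelSpace G := ⟨rfl⟩; ∀ (r : Literature.MathematicalPhysics.QuantumFieldTheory.LatticeRep G), let St : ℕ → ℕ → Type := fun S T => Literature.MathematicalPhysics.QuantumFieldTheory.FinTorusSite S S S T; let Cfg : ℕ → ℕ → Type := fun S T => Literature.MathematicalPhysics.QuantumFieldTheory.FinTorusSite S S S T × Fin 4 → G; let cc : (n : ℕ) → Fin n → ℤ := fun n i => if 2 * i.val < n then (i.val : ℤ) else (i.val : ℤ) - n; let posE : (S T : ℕ) → St S T → EuclideanSpace ℝ (Fin 4) := fun S T x => Literature.MathematicalPhysics.QuantumLattice.siteToE (d := 4) ![cc T x.2.2.2, cc S x.1,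 cc S x.2.1, cc S x.2.2.1]; let P : (S T : ℕ) → St S T → Fin 4 → Fin 4 → Cfg S T → ℝ := fun _ _ x i j U => (r.ρ (Literature.MathematicalPhysics.QuantumFieldTheory.finTorusPlaquette U x i j)).trace.re; let A : (S T : ℕ) → St S T → Cfg S T → ℝ := fun S T x U => ∑ q : {q : Fin 4 × Fin 4 // q.1 < q.2}, P S T x q.1.1 q.1.2 U; let w : ℝ → (S T : ℕ) → Cfg S T → ℝ := fun β S T U => Real.exp (-β * ∑ x : St S T, ∑ q : {q : Fin 4 × Fin 4 // q.1 < q.2}, ((r.N : ℝ) - P S T x q.1.1 q.1.2 U)); let E : ℝ → (S T : ℕ) → (Cfg S T → ℝ) → ℝ := fun β S T F => (∫ U : Literature.MathematicalPhysics.QuantumFieldTheory.FinTorusSite S S S T × Fin 4 → G, F U * w β S T U ∂MeasureTheory.Measure.pi (fun _ => Literature.MathematicalPhysics.QuantumFieldTheory.haarProbability G)) / Literature.MathematicalPhysics.QuantumFieldTheory.wilsonFinTorusPartition r.ρ β S S S T; let Cov : ℝ → (S T : ℕ) → (Cfg S T → ℝ) → (Cfg S T → ℝ) → ℝ := fun β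 S T F F' => E β S T (fun U => F U * F' U) - E β S T F * E β S T F'; let refl : (S T : ℕ) → Cfg S T → Cfg S T := fun _ T U e => if e.2 = Fin.last 3 then (U ((e.1.1, e.1.2.1, e.1.2.2.1, Fin.rev e.1.2.2.2), Fin.last 3))⁻¹ else U ((e.1.1, e.1.2.1, e.1.2.2.1, ⟨(T - e.1.2.2.2.val) % T, Nat.mod_lt _ e.1.2.2.2.pos⟩), e.2); let B : (S T : ℕ) → ℝ → SchwartzMap (EuclideanSpace ℝ (Fin 4)) ℝ → Cfg S T → ℝ := fun S T s f U => ∑ x : St S T, f (s • posE S T x) * A S T x U; let Qrp : ℝ → (S T : ℕ) → ℝ → SchwartzMap (EuclideanSpace ℝ (Fin 4)) ℝ → ℝ := fun β S T s f => Cov β S T (fun U => B S T s f (refl S T U)) (B S T s f); let LF : ℝ → SchwartzMap (EuclideanSpace ℝ (Fin 4)) ℝ → ℝ → (Fin 3 → ℝ) → ℂ := fun s f E p => ∑' x : Fin 4 → ℤ, (((f (s • Literature.MathematicalPhysics.QuantumLattice.siteToE (d := 4) x) * Real.exp (-(E * (s * (x 0 : ℝ))))) : ℝ) : ℂ) * Complex.exp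 (Complex.I * ((s * ∑ k : Fin 3, p k * (x k.succ : ℝ) : ℝ) : ℂ)); ∀ (β : ℝ) (L : ℕ) (s R c : ℝ) (f g : SchwartzMap (EuclideanSpace ℝ (Fin 4)) ℝ), 0 ≤ β → 1 ≤ L → 0 < s → 0 ≤ c → tsupport (f : EuclideanSpace ℝ (Fin 4) → ℝ) ⊆ {y : EuclideanSpace ℝ (Fin 4) | 0 < y 0} → tsupport (f : EuclideanSpace ℝ (Fin 4) → ℝ) ⊆ Metric.closedBall (0 : EuclideanSpace ℝ (Fin 4)) R → tsupport (g : EuclideanSpace ℝ (Fin 4) → ℝ) ⊆ {y : EuclideanSpace ℝ (Fin 4) | 0 < y 0} → tsupport (g : EuclideanSpace ℝ (Fin 4) → ℝ) ⊆ Metric.closedBall (0 : EuclideanSpace ℝ (Fin 4)) R → R ≤ s * L → (∀ E : ℝ, 0 ≤ E → ∀ p : Fin 3 → ℝ, c * ‖LF s g E p‖ ≤ ‖LF s f E p‖) → ∀ Qf Qg : ℝ, Filter.Tendsto (fun k : ℕ => Qrp β (2 * L + 1) (2 ^ k * (2 * L + 1)) s f) Filter.atTop (nhds Qf) → Filter.Tendsto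 (fun k : ℕ => Qrp β (2 * L + 1) (2 ^ k * (2 * L + 1)) s g) Filter.atTop (nhds Qg) → c ^ 2 * Qg ≤ Qf

theorem stub_thermalLimit : ThermalLimit := by
  sorry

theorem stub_limitDomination : LimitDomination := by
  sorry

/-- Composition (kernel-checked, no sorry): the two stubs give the route crux BY NAME. -/
theorem VacuumDomination_of (hT : ThermalLimit) (hD : LimitDomination) :
    Summit.QuantumFields.YangMills.Theses.SqueezedSkewness.VacuumDomination := by
  intro G _ _ _ _ r
  have hT' := hT G r
  have hD' := hD G r
  dsimp only at hT' hD' ⊢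
  intro β L s R c f g hβ hL hs hc hfpos hfR hgpos hgR hRL hdom ε ε' hε' hfloor
  obtain ⟨Qg, hTg⟩ := hT' β L s R g hβ hL hs hgpos hgR hRL
  obtain ⟨Qf, hTf⟩ := hT' β L s R f hβ hL hs hfpos hfR hRL
  have hcmp : c ^ 2 * Qg ≤ Qf :=
    hD' β L s R c f g hβ hL hs hc hfpos hfR hgpos hgR hRL hdom Qf Qg hTf hTg
  have hεQg : ε ≤ Qg := by
    obtain ⟨k₀, hk⟩ := hfloor
    exact ge_of_tendsto hTg (Filter.eventually_atTop.2 ⟨k₀, hk⟩)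
  have hlt : ε' < Qf := by
    have : c ^ 2 * ε ≤ c ^ 2 * Qg := mul_le_mul_of_nonneg_left hεQg (sq_nonneg c)
    linarith
  obtain ⟨k₀, hk⟩ := Filter.eventually_atTop.1 (hTf.eventually (eventually_gt_nhds hlt))
  exact ⟨k₀, fun k hk' => (hk k hk').le⟩

/-- The crux from the registered stubs. -/
theorem VacuumDomination_holds_of_stubs :
    Summit.QuantumFields.YangMills.Theses.SqueezedSkewness.VacuumDomination :=
  VacuumDomination_of stub_thermalLimit stub_limitDomination

end Summit.QuantumFields.YangMills.Cruxes.NT.VacuumDominationBirth
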